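import Summits.CriticalPhenomena.SAWScalingLimit.Theorems.SAWTotalPositivityBoundaryTP2Defs
import Summits.CriticalPhenomena.SAWScalingLimit.Theorems.EdgeOfPositivity.Negative.EdgeOfPositivityRectDomain
import HarnessLib

/-!
# Crux `BoundaryTP2` (stmt-CriticalPhenomena-7115), line `Sketch`: sharpness of the corner threshold `1/2`

Tool stub `stub_strip3_oddOscillation` of the line's skeleton (lead c6).  On the 3-row strip
`S_L = {0,…,L} × {0,1,2}` the odd sector of the last-column transfer recursion for the self-avoiding
path kernels from the corner `(0,0)` is the pair `(D_L, R_L)` driven by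

  `D_{L+1} = x(1-x²) D_L - x⁴ R_L`,   `R_{L+1} = x² D_L + x³ R_L`,   `(D_0, R_0) = (1-x², x)`,

with `D_L = Z((0,0),(L,0)) - Z((0,0),(L,2))`.  The companion stub `stub_strip3_oddCone` shows
`D_L ≥ 0` for all `L` when `x ≤ 1/2`.  Here the converse (sharpness): for `1/2 < x < 1` some `D_L`
is negative (the eigenvalues `x(1 ± √(1-4x²))/2` are non-real), so the corner inequality fails on a
long enough 3-row strip.  Elementary real algebra only, no eigenvectors: if `D_L ≥ 0` for all `L`
then `D_L, R_L > 0` and the cleared-denominator increment identity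

  `4x² (R_{L+1} D_L - R_L D_{L+1}) = (2x³ R_L - (1-2x²) D_L)² + (4x²-1) D_L²`

gives `L (4x²-1) D_L ≤ 4x² R_L` for all `L`, which forces `D_{L+1} ≤ 0` once `x (4x²-1) L > 4`.
-/

noncomputable section

namespace Summit.CriticalPhenomena.SAWScalingLimit.Theorems.BoundaryTP2

open Literature.Probability.LatticeModels Literature.Probability.RandomPlanarGeometry
open Summit.CriticalPhenomena.SAWScalingLimit.Theorems.EdgeOfPositivity.Negative
open scoped ENNReal

/-- **Tool stub `stub_strip3_oddOscillation`** (sharpness of the corner threshold `x = 1/2` on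
3-row strips). For `1/2 < x < 1`, every pair of real sequences with
`D_{L+1} = x(1-x²)D_L - x⁴R_L`, `R_{L+1} = x²D_L + x³R_L`, `D_0 = 1-x²`, `R_0 = x` has some
`D_L < 0`.  Proof by contradiction: if `D_L ≥ 0` for all `L` then `R_L > 0` and `D_L > 0`
(`D_L = 0` would give `D_{L+1} = -x⁴R_L < 0`); the identity
`4x²(R_{L+1}D_L - R_LD_{L+1}) = (2x³R_L - (1-2x²)D_L)² + (4x²-1)D_L²` together with
`D_{L+1} ≤ D_L` yields `L(4x²-1)D_L ≤ 4x²R_L` by induction, and then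
`4x² D_{L+1} ≤ x³ D_L (4(1-x²) - x(4x²-1)L) < 0` for `L > 4/(x(4x²-1))`. [folklore] -/
theorem stub_strip3_oddOscillation {x : ℝ} (hx : 1 / 2 < x) (hx1 : x < 1) (D R : ℕ → ℝ)
    (hD0 : D 0 = 1 - x ^ 2) (hR0 : R 0 = x)
    (hD : ∀ L, D (L + 1) = x * (1 - x ^ 2) * D L - x ^ 4 * R L)
    (hR : ∀ L, R (L + 1) = x ^ 2 * D L + x ^ 3 * R L) :
    ∃ L, D L < 0 := by
  by_contra h
  push Not at h
  have hx0 : 0 < x := by linarith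
  have hν : 0 < 4 * x ^ 2 - 1 := by
    have h1 : 0 < (x - 1 / 2) * (x + 1 / 2) := mul_pos (by linarith) (by linarith)
    linarith
  -- (1) `R_L > 0`
  have hRpos : ∀ L, 0 < R L := by
    intro L
    induction L with
    | zero => rw [hR0]; exact hx0
    | succ L ih =>
      rw [hR L]
      exact add_pos_of_nonneg_of_pos (mul_nonneg (pow_nonneg hx0.le 2) (h L))
        (mul_pos (pow_pos hx0 3) ih)
  -- (2) `D_L > 0`: `D_0 = 1 - x² > 0`, and `D_{L+1} = 0` would force `D_{L+2} = -x⁴ R_{L+1} < 0`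
  have hDpos : ∀ L, 0 < D L := by
    intro L
    cases L with
    | zero =>
      rw [hD0]
      have h1 : 0 < (1 - x) * (1 + x) := mul_pos (by linarith) (by linarith)
      linarith
    | succ L =>
      rcases (h (L + 1)).lt_or_eq with hlt | heq
      · exact hlt
      · exfalso
        have h1 := h (L + 1 + 1)
        rw [hD (L + 1), ← heq] at h1
        have h2 : 0 < x ^ 4 * R (L + 1) := mul_pos (pow_pos hx0 4) (hRpos (L + 1))
        linarith
  -- (3) `D_{L+1} ≤ D_L`
  have hDD : ∀ L, D (L + 1) ≤ D L := by
    intro L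
    rw [hD L]
    have h1 : 0 ≤ D L * (1 - x) := mul_nonneg (hDpos L).le (by linarith)
    have h2 : 0 ≤ D L * x ^ 3 := mul_nonneg (hDpos L).le (pow_nonneg hx0.le 3)
    have h3 : 0 ≤ x ^ 4 * R L := mul_nonneg (pow_nonneg hx0.le 4) (hRpos L).le
    linarith
  -- (4) the ratio `R_L / D_L` grows at least linearly (cleared denominators)
  have hclaim : ∀ L : ℕ, (L : ℝ) * (4 * x ^ 2 - 1) * D L ≤ 4 * x ^ 2 * R L := by
    intro L
    induction L with
    | zero =>
      simp only [Nat.cast_zero, zero_mul]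
      exact mul_nonneg (by positivity) (hRpos 0).le
    | succ L ih =>
      push_cast
      refine le_of_mul_le_mul_right ?_ (hDpos L)
      have key : 4 * x ^ 2 * (R (L + 1) * D L) = 4 * x ^ 2 * (R L * D (L + 1))
          + (2 * x ^ 3 * R L - (1 - 2 * x ^ 2) * D L) ^ 2 + (4 * x ^ 2 - 1) * D L ^ 2 := by
        rw [hR L, hD L]; ring
      have hsq : 0 ≤ (2 * x ^ 3 * R L - (1 - 2 * x ^ 2) * D L) ^ 2 := sq_nonneg _
      have ih' : (L : ℝ) * (4 * x ^ 2 - 1) * D L * D (L + 1) ≤ 4 * x ^ 2 * R L * D (L + 1) :=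
        mul_le_mul_of_nonneg_right ih (hDpos (L + 1)).le
      have hνDD : (4 * x ^ 2 - 1) * D L * D (L + 1) ≤ (4 * x ^ 2 - 1) * D L * D L :=
        mul_le_mul_of_nonneg_left (hDD L) (mul_nonneg hν.le (hDpos L).le)
      linarith
  -- (5) Archimedes: for `x (4x²-1) L > 4` the next term `D_{L+1}` would be `≤ 0`
  obtain ⟨L, hL⟩ := exists_nat_gt (4 / (x * (4 * x ^ 2 - 1)))
  rw [div_lt_iff₀ (mul_pos hx0 hν)] at hL
  have f1 : x ^ 4 * ((L : ℝ) * (4 * x ^ 2 - 1) * D L) ≤ x ^ 4 * (4 * x ^ 2 * R L) :=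
    mul_le_mul_of_nonneg_left (hclaim L) (pow_nonneg hx0.le 4)
  have f2 : 4 * (x ^ 3 * D L) < (L : ℝ) * (x * (4 * x ^ 2 - 1)) * (x ^ 3 * D L) :=
    mul_lt_mul_of_pos_right hL (mul_pos (pow_pos hx0 3) (hDpos L))
  have f3 : 0 ≤ x ^ 5 * D L := mul_nonneg (pow_nonneg hx0.le 5) (hDpos L).le
  have f4 : 0 < 4 * x ^ 2 * (x * (1 - x ^ 2) * D L - x ^ 4 * R L) := by
    rw [← hD L]
    exact mul_pos (by positivity) (hDpos (L + 1))
  linarith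

end Summit.CriticalPhenomena.SAWScalingLimit.Theorems.BoundaryTP2
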